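import Summits.AnomalousDissipation.AnomalousDissipation.Theses.TwoAndHalfD
import Summits.AnomalousDissipation.AnomalousDissipation.Theorems.TwoAndHalfDTwohalfdThesisLine
import Summits.AnomalousDissipation.AnomalousDissipation.Theorems.TwoAndHalfDTwohalfdThesisStubWeakDuhamel
import Summits.AnomalousDissipation.AnomalousDissipation.Theorems.TwoAndHalfDTwohalfdThesisStubDuhamelVariance
import Summits.AnomalousDissipation.AnomalousDissipation.Theorems.TwoAndHalfDTwohalfdThesisStubDissipationFloor
import Summits.AnomalousDissipation.AnomalousDissipation.Theorems.TwoAndHalfDTwohalfdThesisClassicalTransfer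
import Summits.AnomalousDissipation.AnomalousDissipation.Theorems.TwoAndHalfDScalarAnomalySteadySourceFormalColdStartVariance
import Summits.AnomalousDissipation.AnomalousDissipation.Theorems.ScalarAnomalySteadySourceFormal.Negative.ForcedClassicalWeak
import Literature.Analysis.FluidPDE.TorusClassicalLerayHopfProofs
import Literature.Barriers.AnomalousDissipation.GravestModeLaminarAttractorSwept

/-!
# Crux `TwoAndHalfD.TwohalfdThesis` (stmt-AnomalousDissipation-0206): the SHARED CLASSICAL CORE of the two cruxes
# `TwohalfdThesis` (#0, X) and `ScalarAnomalySteadySourceFormal` (#2)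

Support file of the line `Sketch` (duhamel-release), lead c1 (`--supports stmt-AnomalousDissipation-0206`; everything
proved, standard axioms).  It makes the lead's promotion recommendation kernel-checked: the CLASSICAL STEADY-SOURCE SCALAR
ANOMALY PACKAGE

  `(#2c)`  smooth solenoidal mean-zero steady planar force `g`, smooth mean-zero source `h`, `ν_j → 0`, classical
           solutions `(v_j, p_j)` of the planar Navier–Stokes system forced by `g` on `[0, ∞) × T²`, classical solutions
           `θ_j` of `∂ₜθ + v_j·∇θ = ν_jΔθ + h` on `[0, ∞)`, POINTWISE budgets `∫‖v_j(t)‖² ≤ E`, `‖θ_j(t)‖² ≤ B`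
           (`t ≥ 0`) and the floor `⟨ν_j‖∇θ_j‖²⟩ ≥ ε > 0` (spectral, `toReal`, limsup-mean),

spelled out verbatim as the hypothesis of the landed junction `twohalfdThesis_of_classicalScalarAnomaly` (p90898), is

* implied by this line's residual stub W `stub_releasedMixingWitness` (`classicalScalarAnomaly_of_releasedMixingWitness`:
  cold starts from `ColdStartVariance.exists_global_coldStart`, then the landed D0 `stub_weakDuhamel`, D1
  `stub_duhamelVariance`, D2 `stub_dissipationFloor`);
* sufficient for the route TARGET `TwohalfdThesis` (p90898) AND for the sibling crux `ScalarAnomalySteadySourceFormal`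
  BY NAME (`scalarAnomalySteadySourceFormal_of_classicalScalarAnomaly`: classical NS ⇒ global Leray–Hopf from its own
  slice, `IsClassicalNSSolutionOn.isLerayHopfOn_of_convex`; classical sourced scalar ⇒ weak sourced scalar from its own
  slice, `Negative.isWeakScalarTransportForcedOn_of_classical`; pointwise ⇒ limsup-mean budgets,
  `longTimeAvgSup_le_of_forall_le`);

so ONE item carrying `(#2c)` closes both cruxes (`twohalfdThesis_and_scalarAnomalySteadySourceFormal_of_classicalScalarAnomaly`),
and every witness of W (this line) — like every witness of the sibling line's profile-wise spec S1', which also builds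
`(#2c)` — closes both.  No new mathematics: bookkeeping over landed theorems.  References: Bruè–De Lellis 2023 §3
(2½-D architecture), Doering–Foias 2002 §2 (budgets), Majda–Bertozzi 2002 §2.3.1.
-/

noncomputable section

-- D-0017: single-problem summit ⇒ `Summit.AnomalousDissipation.AnomalousDissipation.…`.
set_option linter.dupNamespace false

namespace Summit.AnomalousDissipation.AnomalousDissipation.Theorems.TwohalfdThesis

open MeasureTheory Set Filter Topology
open scoped ENNReal NNReal InnerProductSpace
open Literature.Analysis.FunctionSpaces Literature.Analysis.FluidPDE
open Summit.AnomalousDissipation.AnomalousDissipation.Theses.TwoAndHalfD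

/-- **W ⇒ (#2c).**  The released-family mixing witness of the line `Sketch` (registered stub
`stub_releasedMixingWitness`, verbatim) yields the classical steady-source scalar anomaly package (hypothesis of
`twohalfdThesis_of_classicalScalarAnomaly`, verbatim): the scalars are the classical cold starts `θ_j` over `v_j`
(`ColdStartVariance.exists_global_coldStart`), their variance is `≤ (s₀+M)²‖h‖²` by the weak Duhamel identity (D0,
`stub_weakDuhamel`) and the envelope (D1, `stub_duhamelVariance`), and the Green–Kubo floor, rewritten through D0 with
`χ = h`, is a liminf-mean input-power floor, which D2 (`stub_dissipationFloor`) turns into `⟨ν_j‖∇θ_j‖²⟩ ≥ ε`. -/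
theorem classicalScalarAnomaly_of_releasedMixingWitness
    (hW : ∃ (g : (UnitAddTorus (Fin 2)) → (EuclideanSpace ℝ (Fin 2))) (h : (UnitAddTorus (Fin 2)) → ℝ),
      Torus.IsSmooth g ∧ Torus.IsDivFree g ∧ Torus.HasZeroMean g ∧ Torus.IsSmooth h ∧ Torus.HasZeroMean h ∧
      ∃ (ν : ℕ → ℝ) (v : ℕ → ℝ → (UnitAddTorus (Fin 2)) → (EuclideanSpace ℝ (Fin 2))) (p : ℕ → ℝ → (UnitAddTorus (Fin 2)) → ℝ) (φ : ℕ → ℝ → ℝ → (UnitAddTorus (Fin 2)) → ℝ)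
        (Λ : ℝ → ℝ) (E s₀ M ε : ℝ),
        (∀ j, 0 < ν j) ∧ Tendsto ν atTop (𝓝 0) ∧
        (∀ j, Torus.IsClassicalNSSolutionOn (Ici 0) (ν j) (fun _ => g) (v j) (p j)) ∧
        (∀ j t, 0 ≤ t → ∫ x, ‖v j t x‖ ^ 2 ≤ E) ∧
        (∀ j s, 0 ≤ s → Torus.IsClassicalScalarTransportOn (Ici s) (ν j) (v j) (φ j s) ∧ φ j s s = h) ∧
        0 ≤ s₀ ∧ (∀ τ, 0 ≤ Λ τ) ∧ IntegrableOn Λ (Ici 0) ∧ (∫ τ in Ici 0, Λ τ) ≤ M ∧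
        (∀ j s t, s₀ ≤ s → s ≤ t → Torus.scalarL2Sq (φ j s t) ≤ Λ (t - s) ^ 2 * Torus.scalarL2Sq h) ∧
        0 < ε ∧
        (∀ j, ε ≤ liminf (timeMean fun t => ∫ s in (0 : ℝ)..t, ∫ x, h x * φ j s t x) atTop)) :
    ∃ (g : UnitAddTorus (Fin 2) → EuclideanSpace ℝ (Fin 2)) (h : UnitAddTorus (Fin 2) → ℝ),
      Torus.IsSmooth g ∧ Torus.IsDivFree g ∧ Torus.HasZeroMean g ∧ Torus.IsSmooth h ∧ Torus.HasZeroMean h ∧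
      ∃ (ν : ℕ → ℝ) (v : ℕ → ℝ → UnitAddTorus (Fin 2) → EuclideanSpace ℝ (Fin 2))
        (p : ℕ → ℝ → UnitAddTorus (Fin 2) → ℝ) (θ : ℕ → ℝ → UnitAddTorus (Fin 2) → ℝ) (E B ε : ℝ),
        (∀ j, 0 < ν j) ∧ Tendsto ν atTop (𝓝 0) ∧
        (∀ j, Torus.IsClassicalNSSolutionOn (Ici 0) (ν j) (fun _ => g) (v j) (p j)) ∧
        (∀ j, Torus.IsClassicalScalarTransportForcedOn (Ici 0) (ν j) (v j) (fun _ => h) (θ j)) ∧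
        (∀ j t, 0 ≤ t → ∫ x, ‖v j t x‖ ^ 2 ≤ E) ∧ (∀ j t, 0 ≤ t → Torus.scalarL2Sq (θ j t) ≤ B) ∧
        0 < ε ∧ (∀ j, ε ≤ longTimeAvgSup (fun t => ν j * (Torus.eScalarGradNormSq (θ j t)).toReal)) := by
  obtain ⟨g, h, hgs, hgd, hgm, hhs, hhm, ν, v, p, φ, Λ, E, s₀, M, ε, hν, hν0, hNS, hE, hφ, hs₀, hΛ0, hΛi, hΛM,
    hEnv, hε, hGK⟩ := hW
  -- the classical cold starts `θ_j`
  have hex : ∀ j, ∃ θ : ℝ → (UnitAddTorus (Fin 2)) → ℝ,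
      Torus.IsClassicalScalarTransportForcedOn (Ici 0) (ν j) (v j) (fun _ => h) θ ∧ θ 0 = fun _ => 0 := fun j =>
    Summit.AnomalousDissipation.AnomalousDissipation.Theorems.ScalarAnomalySteadySourceFormal.ColdStartVariance.exists_global_coldStart
      (hν j) (hNS j).smooth_velocity (hNS j).divFree hhs
  choose θ hθ hθ0 using hex
  -- D0: weak Duhamel
  have hId : ∀ j (χ : (UnitAddTorus (Fin 2)) → ℝ), Torus.IsSmooth χ → ∀ t, 0 ≤ t →
      ∫ x, θ j t x * χ x = ∫ s in (0 : ℝ)..t, ∫ x, φ j s t x * χ x := fun j =>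
    stub_weakDuhamel (ν j) (v j) h (θ j) (φ j) (hν j) hhs (hθ j) (hθ0 j) (hφ j)
  -- D1: the variance bound
  have hVar : ∀ j t, 0 ≤ t → Torus.scalarL2Sq (θ j t) ≤ (s₀ + M) ^ 2 * Torus.scalarL2Sq h := fun j =>
    stub_duhamelVariance (ν j) s₀ M (v j) h (θ j) (φ j) Λ (hν j).le hhs (hθ j) (hφ j) (hId j) hs₀ hΛ0 hΛi hΛM
      (hEnv j)
  -- the Green–Kubo floor is an input-power floor (D0 with `χ = h`)
  have hPow : ∀ j, ε ≤ liminf (timeMean fun t => ∫ x, h x * θ j t x) atTop := by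
    intro j
    have heq : (timeMean fun t => ∫ s in (0 : ℝ)..t, ∫ x, h x * φ j s t x) =ᶠ[atTop]
        (timeMean fun t => ∫ x, h x * θ j t x) := by
      filter_upwards [eventually_ge_atTop (0 : ℝ)] with T hT
      unfold timeMean
      congr 1
      refine intervalIntegral.integral_congr fun t ht => ?_
      rw [uIcc_of_le hT] at ht
      have e := hId j h hhs t ht.1
      simp_rw [mul_comm (h _)]
      exact e.symm
    rw [← Filter.liminf_congr heq]
    exact hGK j
  -- D2: the dissipation floor
  have hDiss : ∀ j, ε ≤ longTimeAvgSup (fun t => ν j * (Torus.eScalarGradNormSq (θ j t)).toReal) := fun j =>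
    stub_dissipationFloor (ν j) ((s₀ + M) ^ 2 * Torus.scalarL2Sq h) ε (v j) h (θ j) (hν j).le hhs (hθ j) (hVar j)
      (hPow j)
  exact ⟨g, h, hgs, hgd, hgm, hhs, hhm, ν, v, p, θ, E, (s₀ + M) ^ 2 * Torus.scalarL2Sq h, ε, hν, hν0, hNS, hθ,
    hE, hVar, hε, hDiss⟩

/-- **(#2c) ⇒ crux #2 `ScalarAnomalySteadySourceFormal` BY NAME.**  The classical steady-source scalar anomaly package
(hypothesis of `twohalfdThesis_of_classicalScalarAnomaly`, verbatim) witnesses the sibling crux with the SAME `g, h, ν_j`,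
the planar velocities `v_j` from their own initial slices `v_j 0` (classical ⇒ global Leray–Hopf,
`IsClassicalNSSolutionOn.isLerayHopfOn_of_convex`), the scalars `θ_j` from their own slices `θ_j 0 ∈ L²` (smooth;
classical ⇒ weak sourced, `Negative.isWeakScalarTransportForcedOn_of_classical`), limsup-mean budgets from the pointwise
ones (`longTimeAvgSup_le_of_forall_le`, integrands nonnegative) and the identical dissipation floor. -/
theorem scalarAnomalySteadySourceFormal_of_classicalScalarAnomaly :
    (∃ (g : UnitAddTorus (Fin 2) → EuclideanSpace ℝ (Fin 2)) (h : UnitAddTorus (Fin 2) → ℝ),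
      Torus.IsSmooth g ∧ Torus.IsDivFree g ∧ Torus.HasZeroMean g ∧ Torus.IsSmooth h ∧ Torus.HasZeroMean h ∧
      ∃ (ν : ℕ → ℝ) (v : ℕ → ℝ → UnitAddTorus (Fin 2) → EuclideanSpace ℝ (Fin 2))
        (p : ℕ → ℝ → UnitAddTorus (Fin 2) → ℝ) (θ : ℕ → ℝ → UnitAddTorus (Fin 2) → ℝ) (E B ε : ℝ),
        (∀ j, 0 < ν j) ∧ Tendsto ν atTop (𝓝 0) ∧
        (∀ j, Torus.IsClassicalNSSolutionOn (Ici 0) (ν j) (fun _ => g) (v j) (p j)) ∧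
        (∀ j, Torus.IsClassicalScalarTransportForcedOn (Ici 0) (ν j) (v j) (fun _ => h) (θ j)) ∧
        (∀ j t, 0 ≤ t → ∫ x, ‖v j t x‖ ^ 2 ≤ E) ∧ (∀ j t, 0 ≤ t → Torus.scalarL2Sq (θ j t) ≤ B) ∧
        0 < ε ∧ (∀ j, ε ≤ longTimeAvgSup (fun t => ν j * (Torus.eScalarGradNormSq (θ j t)).toReal))) →
    ScalarAnomalySteadySourceFormal := by
  rintro ⟨g, h, hgs, hgd, hgm, hhs, hhm, ν, v, p, θ, E, B, ε, hν, hν0, hNS, hθ, hE, hB, hε, hDiss⟩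
  refine ⟨g, h, hgs, hgd, hgm, hhs, hhm, ν, fun j => v j 0, v, fun j => θ j 0, θ, hν, hν0, ?_, ?_, ?_,
    ⟨E, fun j => ?_⟩, ⟨B, fun j => ?_⟩, ε, hε, hDiss⟩
  · intro j T hT
    exact (hNS j).isLerayHopfOn_of_convex (convex_Ici 0) hT Icc_subset_Ici_self
  · intro j
    exact ((hθ j).smooth_scalar.isSmooth_slice (le_refl (0 : ℝ))).memLp 2
  · intro j T _hT
    exact Summit.AnomalousDissipation.AnomalousDissipation.Theorems.ScalarAnomalySteadySourceFormal.Negative.isWeakScalarTransportForcedOn_of_classical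
      (hθ j) Icc_subset_Ici_self
  · exact Literature.Barriers.AnomalousDissipation.meanEnergy_le_of_forall_le (fun t ht => hE j t ht.le)
  · exact Literature.Barriers.AnomalousDissipation.longTimeAvgSup_le_of_forall_le
      (fun t _ => Torus.scalarL2Sq_nonneg _) (fun t ht => hB j t ht.le)

/-- **One package, both cruxes.**  The classical steady-source scalar anomaly package `(#2c)` gives the route target
`TwohalfdThesis` (crux #0, via the landed junction `twohalfdThesis_of_classicalScalarAnomaly`) and the sibling crux
`ScalarAnomalySteadySourceFormal` (crux #2, `scalarAnomalySteadySourceFormal_of_classicalScalarAnomaly`) at once — the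
kernel-checked form of the recommendation "promote (#2c) as ONE item wanted by stmt-0206 and stmt-0448". -/
theorem twohalfdThesis_and_scalarAnomalySteadySourceFormal_of_classicalScalarAnomaly
    (hC : ∃ (g : UnitAddTorus (Fin 2) → EuclideanSpace ℝ (Fin 2)) (h : UnitAddTorus (Fin 2) → ℝ),
      Torus.IsSmooth g ∧ Torus.IsDivFree g ∧ Torus.HasZeroMean g ∧ Torus.IsSmooth h ∧ Torus.HasZeroMean h ∧
      ∃ (ν : ℕ → ℝ) (v : ℕ → ℝ → UnitAddTorus (Fin 2) → EuclideanSpace ℝ (Fin 2))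
        (p : ℕ → ℝ → UnitAddTorus (Fin 2) → ℝ) (θ : ℕ → ℝ → UnitAddTorus (Fin 2) → ℝ) (E B ε : ℝ),
        (∀ j, 0 < ν j) ∧ Tendsto ν atTop (𝓝 0) ∧
        (∀ j, Torus.IsClassicalNSSolutionOn (Ici 0) (ν j) (fun _ => g) (v j) (p j)) ∧
        (∀ j, Torus.IsClassicalScalarTransportForcedOn (Ici 0) (ν j) (v j) (fun _ => h) (θ j)) ∧
        (∀ j t, 0 ≤ t → ∫ x, ‖v j t x‖ ^ 2 ≤ E) ∧ (∀ j t, 0 ≤ t → Torus.scalarL2Sq (θ j t) ≤ B) ∧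
        0 < ε ∧ (∀ j, ε ≤ longTimeAvgSup (fun t => ν j * (Torus.eScalarGradNormSq (θ j t)).toReal))) :
    TwohalfdThesis ∧ ScalarAnomalySteadySourceFormal :=
  ⟨twohalfdThesis_of_classicalScalarAnomaly hC, scalarAnomalySteadySourceFormal_of_classicalScalarAnomaly hC⟩

/-- **W ⇒ both cruxes.**  Every witness of the line's residual stub W `stub_releasedMixingWitness` closes the route
target `TwohalfdThesis` (this is the line, `TwohalfdThesis_of` with the landed D0–D2, T2) AND the sibling crux
`ScalarAnomalySteadySourceFormal` (through `(#2c)`). -/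
theorem twohalfdThesis_and_scalarAnomalySteadySourceFormal_of_releasedMixingWitness
    (hW : ∃ (g : (UnitAddTorus (Fin 2)) → (EuclideanSpace ℝ (Fin 2))) (h : (UnitAddTorus (Fin 2)) → ℝ),
      Torus.IsSmooth g ∧ Torus.IsDivFree g ∧ Torus.HasZeroMean g ∧ Torus.IsSmooth h ∧ Torus.HasZeroMean h ∧
      ∃ (ν : ℕ → ℝ) (v : ℕ → ℝ → (UnitAddTorus (Fin 2)) → (EuclideanSpace ℝ (Fin 2))) (p : ℕ → ℝ → (UnitAddTorus (Fin 2)) → ℝ) (φ : ℕ → ℝ → ℝ → (UnitAddTorus (Fin 2)) → ℝ)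
        (Λ : ℝ → ℝ) (E s₀ M ε : ℝ),
        (∀ j, 0 < ν j) ∧ Tendsto ν atTop (𝓝 0) ∧
        (∀ j, Torus.IsClassicalNSSolutionOn (Ici 0) (ν j) (fun _ => g) (v j) (p j)) ∧
        (∀ j t, 0 ≤ t → ∫ x, ‖v j t x‖ ^ 2 ≤ E) ∧
        (∀ j s, 0 ≤ s → Torus.IsClassicalScalarTransportOn (Ici s) (ν j) (v j) (φ j s) ∧ φ j s s = h) ∧
        0 ≤ s₀ ∧ (∀ τ, 0 ≤ Λ τ) ∧ IntegrableOn Λ (Ici 0) ∧ (∫ τ in Ici 0, Λ τ) ≤ M ∧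
        (∀ j s t, s₀ ≤ s → s ≤ t → Torus.scalarL2Sq (φ j s t) ≤ Λ (t - s) ^ 2 * Torus.scalarL2Sq h) ∧
        0 < ε ∧
        (∀ j, ε ≤ liminf (timeMean fun t => ∫ s in (0 : ℝ)..t, ∫ x, h x * φ j s t x) atTop)) :
    TwohalfdThesis ∧ ScalarAnomalySteadySourceFormal :=
  twohalfdThesis_and_scalarAnomalySteadySourceFormal_of_classicalScalarAnomaly
    (classicalScalarAnomaly_of_releasedMixingWitness hW)

end Summit.AnomalousDissipation.AnomalousDissipation.Theorems.TwohalfdThesis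

end
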